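import Summits.Ventures.PercRepro.S1LadderQ
import Summits.Ventures.PercRepro.S2LPTop

/-!
# PercRepro — THE COLOOP LADDER TO THE COLOOP-FREE CORE, EXPLICITLY (p2, gen 30; the level-5 coloop/closure LP,
SUBCLAIM-S2 feeder)

`S1LadderQ`'s lossy ladder (`ladder_lossy_q`: with `c` coloops, `2^c·#Y_N + 2(2^c − 1)·#U_N ≤ #Y_M` and `#U_M = #U_N`
for some matroid `N` of rank `p`) with the matroid NAMED: `N = M ＼ M.coloops`, which is coloop-free, has rank
`r(M) − c` and `|E| − c` points, and inherits every flat bound of `M`. So a cell with coloops reduces to the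
coloop-free cell of the same corank `c` ranks lower at the constant `(Φ − 2(2^c − 1))/2^c`. Nothing is claimed
about any cell.

* `ladder_delete_coloops`, `pairs_delete`, `lines_delete`, `rls_of_delete_coloops`.
Axioms: standard.
-/

open scoped Matroid

namespace PercRepro

namespace S2LP

open Set Finset

variable {α : Type}

/-- **THE EXPLICIT LOSSY LADDER**: with `c` coloops, `N := M ＼ M.coloops` is coloop-free of rank `p`, has `|E| − c`
points, the same `#U(·, q)`, and `2^c·#Y_N(p, q) + 2(2^c − 1)·#U_N(p, q) ≤ #Y_M(p + c, q)`. -/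
theorem ladder_delete_coloops (c : ℕ) : ∀ (M : Matroid α) [M.Finite] (p q : ℕ), M.eRank = ((p + c : ℕ) : ℕ∞) →
    q < p → 1 ≤ q → M.coloops.ncard = c →
      (M ＼ M.coloops).eRank = (p : ℕ∞) ∧ (M ＼ M.coloops).E.ncard + c = M.E.ncard ∧ (M ＼ M.coloops).coloops = ∅ ∧
      Matroid.topCount M (p + c) q = Matroid.topCount (M ＼ M.coloops) p q ∧
      2 ^ c * Matroid.midCount (M ＼ M.coloops) p q + 2 * (2 ^ c - 1) * Matroid.topCount (M ＼ M.coloops) p q ≤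
        Matroid.midCount M (p + c) q := by
  induction c with
  | zero =>
    intro M _ p q hR hq hq1 hc
    have hKfin : M.coloops.Finite := M.ground_finite.subset M.coloops_subset_ground
    have hK : M.coloops = ∅ := (ncard_eq_zero hKfin).1 hc
    rw [hK, Matroid.delete_empty]
    refine ⟨by simpa using hR, by simp, hK, by simp, by simp⟩
  | succ c ih =>
    intro M _ p q hR hq hq1 hc
    have hKfin : M.coloops.Finite := M.ground_finite.subset M.coloops_subset_ground
    obtain ⟨e, he⟩ : M.coloops.Nonempty := by rw [← ncard_pos hKfin]; omega
    have he' : M.IsColoop e := he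
    have heE : e ∈ M.E := he'.mem_ground
    have hR1 : M.eRank = ((p + c + 1 : ℕ) : ℕ∞) := by rw [hR, ← Nat.add_assoc]
    have hR' : (M ＼ {e}).eRank = ((p + c : ℕ) : ℕ∞) := Matroid.eRank_delete_eq he' hR1
    have hcol' : (M ＼ {e}).coloops = M.coloops \ {e} := S1.coloops_delete_singleton_of_isColoop M he'
    have hc' : (M ＼ {e}).coloops.ncard = c := by
      rw [hcol']
      have := ncard_sdiff_singleton_add_one he hKfin
      omega
    obtain ⟨h1, h2, h3, h4, h5⟩ := ih (M ＼ {e}) p q hR' hq hq1 hc'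
    -- `M ＼ {e} ＼ (M.coloops ∖ {e}) = M ＼ M.coloops`
    have hNN : M ＼ {e} ＼ (M ＼ {e}).coloops = M ＼ M.coloops := by
      rw [hcol', Matroid.delete_delete, singleton_union, insert_sdiff_singleton, insert_eq_of_mem he]
    rw [hNN] at h1 h2 h3 h4 h5
    have hE' : (M ＼ {e}).E.ncard + 1 = M.E.ncard := by
      rw [Matroid.delete_ground]; exact ncard_sdiff_singleton_add_one heE M.ground_finite
    refine ⟨h1, by omega, h3, ?_, ?_⟩
    · obtain ⟨q', rfl⟩ : ∃ q', q = q' + 1 := ⟨q - 1, by omega⟩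
      have ht := Matroid.topCount_eq_of_isColoop_of_eRank he' q' (p := p + c) hR1
      rw [show p + (c + 1) = p + c + 1 by ring, ht, h4]
    · have hstep := S1.two_mul_midCount_add_le_of_isColoop_q' M he' (r := p + c) (by omega) hq1
      rw [show p + (c + 1) = p + c + 1 by ring, pow_succ]
      rw [h4] at hstep
      have hX : 1 ≤ 2 ^ c := Nat.one_le_two_pow
      set X := 2 ^ c with hXdef
      set A := Matroid.midCount (M ＼ M.coloops) p q
      set T := Matroid.topCount (M ＼ M.coloops) p q
      set B := Matroid.midCount (M ＼ {e}) (p + c) q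
      set C := Matroid.midCount M (p + c + 1) q
      have e1 : 2 * (X * 2 - 1) * T = 2 * (2 * (X - 1) * T) + 2 * T := by
        have : X * 2 - 1 = 2 * (X - 1) + 1 := by omega
        rw [this]; ring
      have e2 : X * 2 * A = 2 * (X * A) := by ring
      rw [e1, e2]
      omega

/-- Pairs keep rank `2` in a deletion. -/
theorem pairs_delete (M : Matroid α) (D : Set α) (hpairs : ∀ e ∈ M.E, ∀ f ∈ M.E, e ≠ f → M.eRk {e, f} = 2) :
    ∀ a ∈ (M ＼ D).E, ∀ b ∈ (M ＼ D).E, a ≠ b → (M ＼ D).eRk {a, b} = 2 := by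
  intro a ha b hb hab
  rw [Matroid.delete_ground] at ha hb
  rw [Matroid.delete_eq_restrict, Matroid.restrict_eRk_eq _ (by
    intro x hx
    rcases hx with rfl | rfl
    · exact ha
    · exact hb)]
  exact hpairs a ha.1 b hb.1 hab

/-- The line bound passes to a deletion. -/
theorem lines_delete (M : Matroid α) (D : Set α) (hlines : ∀ L ⊆ M.E, M.eRk L = 2 → L.ncard ≤ 3) :
    ∀ L ⊆ (M ＼ D).E, (M ＼ D).eRk L = 2 → L.ncard ≤ 3 := by
  intro L hL hr
  rw [Matroid.delete_ground] at hL
  rw [Matroid.delete_eq_restrict, Matroid.restrict_eRk_eq _ hL] at hr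
  exact hlines L (hL.trans sdiff_subset) hr

/-- **THE REDUCTION TO THE COLOOP-FREE CORE AT A REDUCED CONSTANT**: if `M` has exactly `c` coloops, rank `p + c`,
and its core `N = M ＼ M.coloops` satisfies `κ·#U_N(p, q) ≤ #Y_N(p, q)` with `Φ ≤ 2^c·κ + 2(2^c − 1)`, then
`Φ·#U_M(p + c, q) ≤ #Y_M(p + c, q)`. -/
theorem phi_mul_topCount_le_of_delete_coloops (M : Matroid α) [M.Finite] {p q c : ℕ} (hR : M.eRank = ((p + c : ℕ) : ℕ∞))
    (hq : q < p) (hq1 : 1 ≤ q) (hc : M.coloops.ncard = c) {Φ κ : ℚ} (hΦ : Φ ≤ 2 ^ c * κ + 2 * (2 ^ c - 1))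
    (hN : κ * (Matroid.topCount (M ＼ M.coloops) p q : ℚ) ≤ (Matroid.midCount (M ＼ M.coloops) p q : ℚ)) :
    Φ * (Matroid.topCount M (p + c) q : ℚ) ≤ (Matroid.midCount M (p + c) q : ℚ) := by
  obtain ⟨-, -, -, htop, hmid⟩ := ladder_delete_coloops c M p q hR hq hq1 hc
  rw [htop]
  have hX : 1 ≤ 2 ^ c := Nat.one_le_two_pow
  have hmidQ : (2 : ℚ) ^ c * (Matroid.midCount (M ＼ M.coloops) p q : ℚ) +
      2 * ((2 : ℚ) ^ c - 1) * (Matroid.topCount (M ＼ M.coloops) p q : ℚ) ≤ (Matroid.midCount M (p + c) q : ℚ) := by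
    have h : ((2 ^ c * Matroid.midCount (M ＼ M.coloops) p q + 2 * (2 ^ c - 1) * Matroid.topCount (M ＼ M.coloops) p q : ℕ) : ℚ) ≤
        ((Matroid.midCount M (p + c) q : ℕ) : ℚ) := by exact_mod_cast hmid
    rw [Nat.cast_add, Nat.cast_mul, Nat.cast_mul, Nat.cast_mul, Nat.cast_sub hX] at h
    push_cast at h
    linarith
  have hT : (0 : ℚ) ≤ (Matroid.topCount (M ＼ M.coloops) p q : ℚ) := by positivity
  have hpow : (0 : ℚ) ≤ 2 ^ c := by positivity
  nlinarith [mul_le_mul_of_nonneg_right hΦ hT, mul_le_mul_of_nonneg_left hN hpow]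

end S2LP

end PercRepro
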